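import Mathlib.Tactic

/-!
# The kernel identity `ker Φ_a = R_μ` — checked instances with `M' ∣ p - 1` (bsd-idea-19 g24; two-parity line)

Model of §5 of `Cruxes/ManinPrimeToAdditiveFiveLe/Lines/two-parity-modular-unit-note.md`.  When `M' ∣ p-1` a primitive
`M'`-th root of unity `ζ` lies in `𝔽_p` (`ζ = g^((p-1)/M')` for a generator `g`, checked inside the Boolean), and the map
`Φ_a : μ ↦ (coef_K(γ))`, `coef_K(γ) = Σ_{kc=K, p∤k} k^(1-2a) Σ_t μ((k,t)γ⁻¹) ζ^(tc)`, is `𝔽_p`-linear on functions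
`μ : (ℤ/M')² → 𝔽_p`.  `R_μ` is spanned by `1_{v ≡ w (d)} - (M'/d)^(2a) δ_{(M'/d)w}` (`d ∣ M'`, `d < M'`).
The Boolean `shadowCheck p M' a g` verifies: `ζ` is a primitive `M'`-th root; every listed row of `Φ_a` (cusps `γ` from three
unipotent/Weyl families, `1 ≤ K ≤ 2M'`) kills every generator of `R_μ`; and `rank(rows) + rank(R_μ) = M'²`.  Together these give
`ker(Φ_a restricted to the listed rows) = R_μ`, hence `ker Φ_a = R_μ` (all rows kill `R_μ` by the distribution relations; more rows only
shrink the kernel).  Closed by `native_decide` (compiled evaluation; workfile, imported by nothing).  BSD / C5 / R / I9 untouched.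
-/

set_option linter.dupNamespace false

namespace Summit.BirchSwinnertonDyer.BirchSwinnertonDyer.Cruxes.ManinPrimeToAdditiveFiveLe.TwoParity

/-- flattened index of `(v0, v1) ∈ (ℤ/M)²` -/
def idx2 (M v0 v1 : ℕ) : ℕ := (v0 % M) * M + (v1 % M)

/-- three families of matrices `(A,B,C,D)` mod `M` of determinant `1`: lower unipotent, Weyl·unipotent, upper unipotent -/
def gammaList (M : ℕ) : List (ℕ × ℕ × ℕ × ℕ) :=
  ((List.range M).map (fun t => (1, 0, t, 1))) ++ ((List.range M).map (fun t => (0, M - 1, 1, t))) ++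
    ((List.range M).map (fun t => (1, t, 0, 1)))

/-- add `val` (mod `p`) to entry `j` of a row -/
def addAt (p : ℕ) (row : List ℕ) (j val : ℕ) : List ℕ := row.set j ((row.getD j 0 + val) % p)

/-- the row of `Φ_a` at the cusp `γ = (A,B;C,D)` and index `K`, as coefficients of `μ(v)`, `v ∈ (ℤ/M)²` -/
def phiRow (p M a zeta : ℕ) (g : ℕ × ℕ × ℕ × ℕ) (K : ℕ) : List ℕ :=
  match g with
  | (A, B, C, D) =>
    let i0 := D % M          -- γ⁻¹ = (D, -B; -C, A)
    let i1 := (M - B % M) % M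
    let i2 := (M - C % M) % M
    let i3 := A % M
    let e := (2 * (p - 1) + 1 - 2 * a) % (p - 1)   -- exponent representing 1 - 2a mod p-1
    (List.range K).foldl (fun row k' =>
        let k := k' + 1
        if K % k == 0 && k % p != 0 then
          let c := K / k
          let kk := (k ^ e) % p
          (List.range M).foldl (fun row t =>
              addAt p row (idx2 M (k * i0 + t * i2) (k * i1 + t * i3)) (kk * ((zeta ^ (t * c % M)) % p)))
            row
        else row)
      ((List.range (M * M)).map (fun _ => 0))

/-- generators of `R_μ` -/
def rmuGens (p M a : ℕ) : List (List ℕ) :=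
  (List.range M).foldr (fun d acc =>
      if d == 0 || M % d != 0 then acc
      else
        let e := M / d
        ((List.range d).foldr (fun w0 acc2 =>
            ((List.range d).map (fun w1 =>
                let r := (List.range (M * M)).map (fun j => if (j / M) % d == w0 && (j % M) % d == w1 then 1 else 0)
                let j0 := idx2 M (e * w0) (e * w1)
                r.set j0 ((r.getD j0 0 + p - (e ^ (2 * a)) % p) % p))) ++ acc2)
          []) ++ acc)
    []

/-- reduce a row against a sorted pivot list (each pivot row has leading `1` at its column) -/
def reduceRow (p : ℕ) (r : List ℕ) (piv : List (ℕ × List ℕ)) : List ℕ :=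
  piv.foldl (fun r cp =>
      let c := r.getD cp.1 0
      if c == 0 then r else List.zipWith (fun x y => (x + (p - c * y % p)) % p) r cp.2)
    r

def insertSorted (cp : ℕ × List ℕ) (piv : List (ℕ × List ℕ)) : List (ℕ × List ℕ) :=
  (piv.filter (fun q => q.1 < cp.1)) ++ [cp] ++ (piv.filter (fun q => cp.1 < q.1))

/-- rank over `𝔽_p` of a list of rows, by Gaussian elimination -/
def rankModP (p : ℕ) (rows : List (List ℕ)) : ℕ :=
  (rows.foldl (fun piv r =>
      let r' := reduceRow p (r.map (fun x => x % p)) piv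
      match r'.findIdx? (fun x => x != 0) with
      | none => piv
      | some col =>
        let inv := ((r'.getD col 0) ^ (p - 2)) % p
        insertSorted (col, r'.map (fun x => x * inv % p)) piv)
    []).length

def dotMod (p : ℕ) (r s : List ℕ) : ℕ := (List.zipWith (fun x y => x * y) r s).sum % p

/-- the listed rows of `Φ_a` (cusps from `gammaList`, `1 ≤ K ≤ 2M'`), with `ζ = g^((p-1)/M')` -/
def phiRows (p M a g : ℕ) : List (List ℕ) :=
  let zeta := (g ^ ((p - 1) / M)) % p
  ((gammaList M).map (fun gm => (List.range (2 * M)).map (fun K' => phiRow p M a zeta gm (K' + 1)))).foldr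
    (fun l acc => l ++ acc) []

/-- `(rank of the listed rows of Φ_a, rank of the generators of R_μ)` over `𝔽_p` -/
def shadowRanks (p M a g : ℕ) : ℕ × ℕ := (rankModP p (phiRows p M a g), rankModP p (rmuGens p M a))

/-- the kernel-identity check at `(p, M', a)` with `M' ∣ p-1`, `g` a generator of `𝔽_pˣ` (only `ζ = g^((p-1)/M')` primitive is
used, and that is checked) -/
def shadowCheck (p M a g : ℕ) : Bool :=
  let zeta := (g ^ ((p - 1) / M)) % p
  let zetaOK := ((List.range M).all (fun i => i == 0 || (zeta ^ i) % p != 1)) && ((zeta ^ M) % p == 1)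
  let rows := phiRows p M a g
  let R := rmuGens p M a
  zetaOK && rows.all (fun r => R.all (fun s => dotMod p r s == 0)) &&
    ((shadowRanks p M a g).1 + (shadowRanks p M a g).2 == M * M)

/-- the content of the check in two cases: the listed rows have rank exactly the number of primitive vectors
(`12` of `16` at `M' = 4`, `96` of `144` at `M' = 12`), neither `0` nor full. -/
theorem shadow_5_4_ranks : shadowRanks 5 4 1 2 = (12, 4) := by native_decide
theorem shadow_13_12_ranks : shadowRanks 13 12 1 2 = (96, 48) := by native_decide

theorem shadow_5_4_a1 : shadowCheck 5 4 1 2 = true := by native_decide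
theorem shadow_5_4_a2 : shadowCheck 5 4 2 2 = true := by native_decide
theorem shadow_7_3_a1 : shadowCheck 7 3 1 3 = true := by native_decide
theorem shadow_7_3_a2 : shadowCheck 7 3 2 3 = true := by native_decide
theorem shadow_7_3_a3 : shadowCheck 7 3 3 3 = true := by native_decide
theorem shadow_7_6_a1 : shadowCheck 7 6 1 3 = true := by native_decide
theorem shadow_7_6_a2 : shadowCheck 7 6 2 3 = true := by native_decide
theorem shadow_7_6_a3 : shadowCheck 7 6 3 3 = true := by native_decide
theorem shadow_11_5_a1 : shadowCheck 11 5 1 2 = true := by native_decide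
theorem shadow_11_5_a2 : shadowCheck 11 5 2 2 = true := by native_decide
theorem shadow_11_10_a1 : shadowCheck 11 10 1 2 = true := by native_decide
theorem shadow_11_10_a2 : shadowCheck 11 10 2 2 = true := by native_decide
theorem shadow_13_6_a1 : shadowCheck 13 6 1 2 = true := by native_decide
theorem shadow_13_6_a3 : shadowCheck 13 6 3 2 = true := by native_decide
theorem shadow_13_12_a1 : shadowCheck 13 12 1 2 = true := by native_decide
theorem shadow_13_12_a2 : shadowCheck 13 12 2 2 = true := by native_decide
theorem shadow_13_12_a6 : shadowCheck 13 12 6 2 = true := by native_decide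

end Summit.BirchSwinnertonDyer.BirchSwinnertonDyer.Cruxes.ManinPrimeToAdditiveFiveLe.TwoParity
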